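/-
Copyright (c) 2026 the pub-hodgecm-mathlib formalisation cell (harness21).  Prover seat hodgecm-mathlib-K2E3-p25 (g3) (L4 architect), HCML Track B «K2-LIT» ∕ h413
(`stmt-HodgeConjecture-24833`).  NR-1′ «LeThree SWEEP» (director s1979∕s1980): the hHC∕hHCB-binding theorems of ★ `K2E3CharLocBddOfLocal` RE-READ under the NARROWED letters
hHC₃ `characterLocallyIntegrableLeThree` ∕ hHCB₃ `normalizedCharacter_locallyBoundedLeThree` (`2 ≤ N ≤ 3`, `v` non-split) — SAME NAMES, namespace `…K2E3CharLocBddOfLocalLeThree`.  2026-09-04.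
-/
import Literature.NumberTheory.Rogawski1990.Ch12Sec7CharacterInputs          -- ★ the target `normalizedCharacter_locallyBounded` and its frame (`Ch1`: `cmDatum … .Local`, `IrrClass.smoothTrace`, `IsRegularElt`; `IsLocSmooth`; `unitModulusChar`)
import Literature.NumberTheory.Automorphic.LocalUnitaryGroupCongrMeasure        -- ★ instances: `(cmDatum L N H).Local v` locally compact, second countable, Hausdorff
import Literature.NumberTheory.Automorphic.CMPrincipalSeriesJacquetEvalOne      -- ★ `nonarchimedeanGroup_unitaryGroupOfForm_local` (`U(H)(L⁺_v)` is non-archimedean)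
import Literature.LinearAlgebra.Matrix.CharpolyDiscTwinBridge                    -- ★ `isUnit_discr_iff_separable_of_monic` (`disc(χ_g)` a unit ⇒ `g` regular)
import Summits.HodgeConjecture.HodgeConjecture.Theorems.F0P3bCharIdentityTransport   -- ★ `smoothTrace_comp_continuousMulEquiv` (characters transport along `Ad(y) : G ≃ₜ* G`)
import Mathlib.MeasureTheory.Measure.Haar.Unique
import HarnessLib
import Summits.HodgeConjecture.HodgeConjecture.Theorems.K2E3CharLocBddOfLocal   -- ★ the original: every non-letter lemma REUSED by qualified name
import Summits.HodgeConjecture.HodgeConjecture.Theorems.K2E3CharLettersLeThreeDefs   -- NR-1′ root: hHC₃ ∕ hHCB₃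

/-!
# NR-1′ twin — ★ `K2E3CharLocBddOfLocal` under the narrowed Harish-Chandra letters (`2 ≤ N ≤ 3`, `v` non-split)

Cell `pub/hodgecm-mathlib`, crux H413 = `stmt-HodgeConjecture-24833`, line L4 `stub_StCharTS`; director rulings NR-1′ (s1979) ∕ «GO — LeThree SWEEP» (s1980); architect memo
`K2/K2E3-p25/g3/NR1-narrowing-cone.K2E3-p25-g3.md`.  THEOREMS ONLY; count-neutral helper (`--supports stmt-HodgeConjecture-24833 --as helper`).  Exactly the theorems of the
original ★ file whose statements bind `Ch1.characterLocallyIntegrable` ∕ `normalizedCharacter_locallyBounded`, copied with the binder TYPE replaced by hHC₃ ∕ hHCB₃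
(★ `K2E3CharLettersLeThreeDefs`), the rank∕non-split arguments supplied at each application (`2 ≤ N`, `N ≤ 3` by `norm_num`; the organ's `∀ w ∣ v, conj • w = w`), an added `hns`
binder where the original head was place-agnostic, and calls into other cone files re-pointed to their twins; every other lemma of the original is used BY QUALIFIED NAME.
No new mathematics.  The original ★ declarations are untouched.

HONEST LABEL: HC_CM is proved only modulo the 7 printed citations (2 remaining named inputs: hLiu418 = `stmt-HodgeConjecture-24832`, h413 = `stmt-HodgeConjecture-24833`) until rung 0
closes; count-neutral; CONDITIONAL on the narrowed letters (stated, not assumed).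

## References
* [Rogawski1990] J. D. Rogawski, *Automorphic Representations of Unitary Groups in Three Variables* (1990), §1.6 p. 5; §4.9 p. 54; §12.5–12.7.
* [HarishChandra1999AdmissibleDistributions] Harish-Chandra, *Admissible Invariant Distributions on Reductive p-adic Groups*, ULS 16 (1999), Thm. 16.3.
-/

set_option autoImplicit false
-- the mandated namespace has the single-problem summit's repeated segment (`HodgeConjecture.HodgeConjecture`)
set_option linter.dupNamespace false

noncomputable section

open NumberField IsDedekindDomain MeasureTheory Measure Filter Topology Literature.NumberTheory.Rogawski1990 Literature.NumberTheory.Automorphic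
open Literature.NumberTheory.Automorphic.UnitaryGroup Summit.HodgeConjecture.HodgeConjecture.Cruxes.H413.F0P3bCharIdentityTransport
open scoped Matrix MatrixGroups NNReal ENNReal Pointwise

open Summit.HodgeConjecture.HodgeConjecture.Cruxes.H413.K2E3CharLettersLeThreeDefs

namespace Summit.HodgeConjecture.HodgeConjecture.Cruxes.H413.K2E3CharLocBddOfLocalLeThree

/-! ## §1 Generic lemmas: characters of a totally disconnected group under scaling and conjugation of the measure -/

section Generic

variable {G : Type*} [Group G] [TopologicalSpace G] [IsTopologicalGroup G] [MeasurableSpace G] [BorelSpace G]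

end Generic

section Nonarchimedean
variable {G : Type*} [Group G] [TopologicalSpace G] [NonarchimedeanGroup G] [LocallyCompactSpace G] [MeasurableSpace G] [BorelSpace G]

end Nonarchimedean

/-! ## §2 The frame `G = U(H)(L⁺_v)`: regularity from the unit equation, `Ad`-invariance of `det` and `χ`, and the socket BY NAME -/

section Frame
variable {R : Type*} [CommRing R] {n : Type*} [Fintype n] [DecidableEq n]

set_option maxHeartbeats 1600000 in
set_option synthInstance.maxHeartbeats 400000 in
open scoped Classical in
/-- **Socket `sig_K2E3CharLocBddOfLocal` BY NAME (U12-f of `K2_E3_EllipticInputsSigs_U12Characters`): local boundedness of `|D_G|^{1∕2} Θ` on every compact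
`C ⊆ G = U(H)(L⁺_v)` (★ `normalizedCharacter_locallyBoundedLeThree`, [HarishChandra1999AdmissibleDistributions, Thm. 16.3]) FROM ‹U12-b› «orbit closures contain semisimple
elements» and ‹U12-d› «the weight is bounded near every semisimple point».**  The two antecedents are the socket module's statements :70–77 and :123–140 token for token.
Proof: §1–§2 above — (0) an admissible unit `u` forces `g` regular; (1) non-admissible representative ⇒ `Θ = 0` at regular points ⇒ `B = 0`; (2) admissible ⇒ `Θ` is
`Ad`-invariant at regular points; (3) semisimple point in the orbit closure, local bound there, pull back along `Ad(x)`, finite subcover of `C`.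
[cite: HarishChandra1999AdmissibleDistributions, §21 p. 87; Thm. 16.3 p. 77] [cite: Rogawski1990, §1.6 p. 5; §12.7 p. 193] -/
theorem charLocBddOfLocal :
    (∀ (L : Type) [Field L] [NumberField L] [IsCMField L] (N : ℕ) (H : Matrix (Fin N) (Fin N) L),
      (H.map (cmConjRingHom L))ᵀ = H → H.det ≠ 0 →
      ∀ (v : HeightOneSpectrum (𝓞 ↥(maximalRealSubfield L)))
        [MeasurableSpace ((UnitaryGroup.cmDatum L N H).Local v)] [BorelSpace ((UnitaryGroup.cmDatum L N H).Local v)]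
        (μ : Measure ((UnitaryGroup.cmDatum L N H).Local v)) [μ.IsHaarMeasure]
        (g : (UnitaryGroup.cmDatum L N H).Local v),
        ∃ s : (UnitaryGroup.cmDatum L N H).Local v, s ∈ closure (Set.range fun x : (UnitaryGroup.cmDatum L N H).Local v => x * g * x⁻¹) ∧ Module.End.IsSemisimple (Matrix.toLin' ((s.val : GL (Fin N) (UnitaryGroup.LocalRing L v)).val : Matrix (Fin N) (Fin N) (UnitaryGroup.LocalRing L v)))) →
    (∀ (L : Type) [Field L] [NumberField L] [IsCMField L] (N : ℕ), 2 ≤ N → N ≤ 3 → ∀ (H : Matrix (Fin N) (Fin N) L),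
      (H.map (cmConjRingHom L))ᵀ = H → H.det ≠ 0 →
      ∀ (v : HeightOneSpectrum (𝓞 ↥(maximalRealSubfield L))), (∀ w : PlacesOver L v, IsCMField.complexConj L • w.1 = w.1) → ∀
        [MeasurableSpace ((UnitaryGroup.cmDatum L N H).Local v)] [BorelSpace ((UnitaryGroup.cmDatum L N H).Local v)]
        (μ : Measure ((UnitaryGroup.cmDatum L N H).Local v)) [μ.IsHaarMeasure]
        (c : IrrClass ((UnitaryGroup.cmDatum L N H).Local v)) (Θ : (UnitaryGroup.cmDatum L N H).Local v → ℂ),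
        LocallyIntegrable Θ μ →
        (∀ x : (UnitaryGroup.cmDatum L N H).Local v,
          IsRegularElt (x.val : GL (Fin N) (UnitaryGroup.LocalRing L v)) → ∀ᶠ y in 𝓝 x, Θ y = Θ x) →
        (∀ φ : (UnitaryGroup.cmDatum L N H).Local v → ℂ, IsLocSmooth φ → c.smoothTrace μ φ = ∫ x, φ x * Θ x ∂μ) →
      ∀ s : (UnitaryGroup.cmDatum L N H).Local v, Module.End.IsSemisimple (Matrix.toLin' ((s.val : GL (Fin N) (UnitaryGroup.LocalRing L v)).val : Matrix (Fin N) (Fin N) (UnitaryGroup.LocalRing L v))) →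
        ∃ U : Set ((UnitaryGroup.cmDatum L N H).Local v), IsOpen U ∧ s ∈ U ∧
        ∃ B : ℝ, ∀ g ∈ U, ∀ u : (UnitaryGroup.LocalRing L v)ˣ,
          (u : UnitaryGroup.LocalRing L v) *
              (((g.val : GL (Fin N) (UnitaryGroup.LocalRing L v)) : Matrix (Fin N) (Fin N) (UnitaryGroup.LocalRing L v)).det) ^ (N - 1) =
            (((g.val : GL (Fin N) (UnitaryGroup.LocalRing L v)) : Matrix (Fin N) (Fin N) (UnitaryGroup.LocalRing L v)).charpoly).discr →
          ((NNReal.sqrt (NNReal.sqrt (unitModulusChar (UnitaryGroup.LocalRing L v) u)) : ℝ≥0) : ℝ) * ‖Θ g‖ ≤ B) →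
    normalizedCharacter_locallyBoundedLeThree := by
  intro hb hd L _ _ _ N hN2 hN3 H hH hdet v hns _ _ μ _ c Θ hΘi hΘc hΘr C hC
  -- `G = U(H)(L⁺_v)` is a second countable locally compact Hausdorff NON-ARCHIMEDEAN group (★ instances + ★ `nonarchimedeanGroup_unitaryGroupOfForm_local`)
  haveI : NonarchimedeanGroup ((UnitaryGroup.cmDatum L N H).Local v) :=
    nonarchimedeanGroup_unitaryGroupOfForm_local (E := L) (c := IsCMField.complexConj L) (N := N) (v := v) (J' := (adelicForm L N H).map (adeleToLocal L v))
  -- (0) only regular points carry a weight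
  have hreg : ∀ (g : (UnitaryGroup.cmDatum L N H).Local v) (u : (UnitaryGroup.LocalRing L v)ˣ),
      (u : UnitaryGroup.LocalRing L v) *
          (((g.val : GL (Fin N) (UnitaryGroup.LocalRing L v)) : Matrix (Fin N) (Fin N) (UnitaryGroup.LocalRing L v)).det) ^ (N - 1) =
        (((g.val : GL (Fin N) (UnitaryGroup.LocalRing L v)) : Matrix (Fin N) (Fin N) (UnitaryGroup.LocalRing L v)).charpoly).discr →
      IsRegularElt (g.val : GL (Fin N) (UnitaryGroup.LocalRing L v)) :=
    fun g u hu => K2E3CharLocBddOfLocal.isRegularElt_of_unit_mul_det_pow_eq_discr _ u (N - 1) hu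
  obtain ⟨r, rfl⟩ := IrrClass.mk_surjective c
  by_cases hadm : r.ρ.IsAdmissible
  · -- (2) `Θ` is `Ad`-invariant at the regular points
    have hval : ∀ x g : (UnitaryGroup.cmDatum L N H).Local v,
        ((x * g * x⁻¹ : (UnitaryGroup.cmDatum L N H).Local v).val : GL (Fin N) (UnitaryGroup.LocalRing L v)) = x.val * g.val * x.val⁻¹ := fun x g => rfl
    have hcl : ∀ x g : (UnitaryGroup.cmDatum L N H).Local v, IsRegularElt (g.val : GL (Fin N) (UnitaryGroup.LocalRing L v)) → Θ (x * g * x⁻¹) = Θ g := by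
      intro x g hg
      have hg' : IsRegularElt ((x * g * x⁻¹ : (UnitaryGroup.cmDatum L N H).Local v).val : GL (Fin N) (UnitaryGroup.LocalRing L v)) := by
        rw [hval]; exact (isRegularElt_conj_iff _ _).2 hg
      have h := K2E3CharLocBddOfLocal.apply_conj_eq_of_isAdmissible r hadm μ Θ hΘr x⁻¹ (hΘc g hg) (by simpa only [inv_inv] using hΘc _ hg')
      simpa only [inv_inv] using h
    -- (3) a local bound at EVERY point
    have hloc : ∀ g₀ : (UnitaryGroup.cmDatum L N H).Local v, ∃ V ∈ 𝓝 g₀, ∃ B : ℝ, ∀ g ∈ V, ∀ u : (UnitaryGroup.LocalRing L v)ˣ,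
        (u : UnitaryGroup.LocalRing L v) *
            (((g.val : GL (Fin N) (UnitaryGroup.LocalRing L v)) : Matrix (Fin N) (Fin N) (UnitaryGroup.LocalRing L v)).det) ^ (N - 1) =
          (((g.val : GL (Fin N) (UnitaryGroup.LocalRing L v)) : Matrix (Fin N) (Fin N) (UnitaryGroup.LocalRing L v)).charpoly).discr →
        ((NNReal.sqrt (NNReal.sqrt (unitModulusChar (UnitaryGroup.LocalRing L v) u)) : ℝ≥0) : ℝ) * ‖Θ g‖ ≤ B := by
      intro g₀
      obtain ⟨s, hs, hss⟩ := hb L N H hH hdet v μ g₀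
      obtain ⟨U, hUo, hsU, B, hB⟩ := hd L N hN2 hN3 H hH hdet v hns μ (IrrClass.mk r) Θ hΘi hΘc hΘr s hss
      obtain ⟨z, hzU, x, rfl⟩ := mem_closure_iff.1 hs U hUo hsU
      refine ⟨(fun g => x * g * x⁻¹) ⁻¹' U, (hUo.preimage (by fun_prop)).mem_nhds hzU, B, fun g hg u hu => ?_⟩
      have hu' : (u : UnitaryGroup.LocalRing L v) *
            ((((x * g * x⁻¹ : (UnitaryGroup.cmDatum L N H).Local v).val : GL (Fin N) (UnitaryGroup.LocalRing L v)) :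
                Matrix (Fin N) (Fin N) (UnitaryGroup.LocalRing L v)).det) ^ (N - 1) =
          ((((x * g * x⁻¹ : (UnitaryGroup.cmDatum L N H).Local v).val : GL (Fin N) (UnitaryGroup.LocalRing L v)) :
                Matrix (Fin N) (Fin N) (UnitaryGroup.LocalRing L v)).charpoly).discr := by
        rw [hval, K2E3CharLocBddOfLocal.det_val_conj, K2E3CharLocBddOfLocal.charpoly_val_conj]; exact hu
      have h := hB (x * g * x⁻¹) hg u hu'
      rwa [hcl x g (hreg g u hu)] at h
    -- compactness of `C`
    choose V hV B hB using hloc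
    obtain ⟨t, -, hCt⟩ := hC.elim_nhds_subcover V fun g _ => hV g
    refine ⟨∑ i ∈ t, |B i|, fun g hg u hu => ?_⟩
    obtain ⟨i, hi, hgi⟩ := Set.mem_iUnion₂.1 (hCt hg)
    exact ((hB i g hgi u hu).trans (le_abs_self _)).trans (Finset.single_le_sum (fun j _ => abs_nonneg (B j)) hi)
  · -- (1) non-admissible representative: `Θ = 0` at every regular point
    refine ⟨0, fun g _ u hu => ?_⟩
    rw [K2E3CharLocBddOfLocal.apply_eq_zero_of_not_isAdmissible r hadm μ Θ hΘr (hΘc g (hreg g u hu)), norm_zero, mul_zero]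

end Frame

end Summit.HodgeConjecture.HodgeConjecture.Cruxes.H413.K2E3CharLocBddOfLocalLeThree

end
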